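import Mathlib
import Summits.Ventures.HodgeRepro.Tier4.Line1.RTFSetting

/-!
# Tier4/Line4/KernelL1 — the kernel of an `L¹` test function: measurability, the orbit regrouping, integrability on
the toric domains

Blind re-derivation cell `pub-hodge-repro`, Tier 4 «prove the step» (README §9–§10), seat t4-L4-p2 (prover, LINE L4,
gen 4; self-cut C-L4-KERNELL1, S14853 — the measure-theoretic layer that the `L¹` relative trace formula of §15 (plan-4
g4, `work/v33/L1Class-STATEMENTS.lean`) and the adelic bridge `Jc = J` consume).  Tree path
`lean/Summits/Ventures/HodgeRepro/Tier4/Line4/KernelL1.lean`.  Mathlib-level; no literature; no `def`.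

THE OBJECTS.  `S : RTF.Setting G` (Line1/RTFSetting): `Γ = S.Gk` discrete, `K_f(x, y) = ∑'_γ f(x⁻¹ γ y)` (`S.kernel`),
the partial kernels `K_f^o(x, y) = ∑'_{γ ∈ o} f(x⁻¹ γ y)` over the rational double cosets `o : S.Orbit` (`S.partialKernel`).
For a COMPACTLY supported `f` the sums are finite (L1-p1's `kernel_support_finite`); for an `L¹` test function they are
infinite, and everything below runs on the POINTWISE absolute summability `∀ x y, Summable (γ ↦ ‖f(x⁻¹ γ y)‖)` — the
(α)-form Poincaré bound of S14790 / (R-12) at singletons, which `LatticeCount.summable_norm_conv_of_isTestL1` supplies for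
`f = f₁ ⋆ f₂`, `f₁ ∈ L¹`, `f₂ ∈ C_c` — and, for the bounds, on the uniform constant `M` of that display.

WHAT IS PROVED.
* `countable_Gk`: a discrete subgroup of a second-countable group is countable (`separableSpace_iff_countable`).
* `stronglyMeasurable_kernel` / `stronglyMeasurable_partialKernel`: the kernel and every partial kernel are strongly
  measurable on `G × G` — pointwise limits of the finite partial sums, continuous, along `atTop : Filter (Finset _)`,
  countably generated for a countable index (`stronglyMeasurable_of_tendsto`); `…_torus` versions on `S.T × S.T'`.
* `hasSum_partialKernel` / `kernel_eq_tsum_partialKernel` / `summable_partialKernel`: the regrouping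
  `K_f = ∑'_o K_f^o` along the fibres of `orbitOf` (`HasSum.tsum_fiberwise`), and its non-negative twin
  `hasSum_tsum_norm_fiber`: `∑'_o ∑'_{γ ∈ o} ‖f(x⁻¹ γ y)‖ = ∑'_γ ‖f(x⁻¹ γ y)‖`.
* `norm_partialKernel_le` / `norm_kernel_le`: `‖K_f^o(x, y)‖ ≤ ∑'_{γ ∈ o} ‖…‖ ≤ ∑'_γ ‖f(x⁻¹ γ y)‖`.
* `integrableOn_kernel_mul_DT'` (inner) and `integrableOn_integral_kernel_mul_DT` (outer): with the uniform bound `M` on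
  `closure D_T × closure D_{T′}`, the integrands of `S.J` are integrable on the toric domains (bounded strongly measurable
  functions on sets of finite Haar measure; the outer integrand is strongly measurable by
  `StronglyMeasurable.integral_prod_right'`), and likewise for every partial kernel.

Nothing here says anything about the status of the Hodge conjecture for CM abelian varieties, which is NOT proved
(HC_CM is NOT proved by anyone in this repository).
-/

set_option autoImplicit false

noncomputable section

namespace Summit.Ventures.HodgeRepro.Tier4.Line4

open MeasureTheory Topology Filter Set Summit.Ventures.HodgeRepro.Tier4 Summit.Ventures.HodgeRepro.Tier4.Line1
  Summit.Ventures.HodgeRepro.Tier4.Line1.RTF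

open scoped ENNReal

variable {G : Type} [Group G] [TopologicalSpace G] [IsTopologicalGroup G] [MeasurableSpace G] [BorelSpace G]
  (S : Setting G)

/-! ## 1. Countability of the rational points -/

omit [IsTopologicalGroup G] [BorelSpace G] in
/-- **A discrete subgroup of a second-countable group is countable**: `S.Gk` is second countable as a subspace, hence
separable, and a separable discrete space is countable. -/
theorem countable_Gk [SecondCountableTopology G] : Countable S.Gk := by
  haveI : DiscreteTopology S.Gk := S.discrete
  exact TopologicalSpace.separableSpace_iff_countable.mp inferInstance

/-! ## 2. Measurability of the kernel and of the partial kernels -/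

/-- **The kernel of a continuous `f` with pointwise absolutely summable Poincaré series is strongly measurable on
`G × G`**: it is the pointwise limit of the finite partial sums `(x, y) ↦ ∑_{γ ∈ F} f(x⁻¹ γ y)` (continuous) along
`atTop : Filter (Finset S.Gk)`, which is countably generated because `S.Gk` is countable. -/
theorem stronglyMeasurable_kernel [SecondCountableTopology G] [Countable S.Gk] {f : G → ℂ} (hf : Continuous f)
    (hs : ∀ x y : G, Summable (fun γ : S.Gk => ‖f (x⁻¹ * γ * y)‖)) :
    StronglyMeasurable (fun p : G × G => S.kernel f p.1 p.2) := by
  refine stronglyMeasurable_of_tendsto (atTop : Filter (Finset S.Gk))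
    (f := fun F : Finset S.Gk => fun p : G × G => ∑ γ ∈ F, f (p.1⁻¹ * γ * p.2)) (fun F => ?_) ?_
  · exact (continuous_finsetSum F fun γ _ =>
      hf.comp ((continuous_fst.inv.mul continuous_const).mul continuous_snd)).stronglyMeasurable
  · rw [tendsto_pi_nhds]
    intro p
    exact ((hs p.1 p.2).of_norm).hasSum

/-- **Every partial kernel is strongly measurable on `G × G`** (the same limit argument on the fibre
`{γ // orbitOf γ = o}`, countable as a subtype of a countable type). -/
theorem stronglyMeasurable_partialKernel [SecondCountableTopology G] [Countable S.Gk] {f : G → ℂ}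
    (hf : Continuous f) (hs : ∀ x y : G, Summable (fun γ : S.Gk => ‖f (x⁻¹ * γ * y)‖)) (o : S.Orbit) :
    StronglyMeasurable (fun p : G × G => S.partialKernel o f p.1 p.2) := by
  refine stronglyMeasurable_of_tendsto (atTop : Filter (Finset {γ : S.Gk // S.orbitOf γ = o}))
    (f := fun F : Finset {γ : S.Gk // S.orbitOf γ = o} => fun p : G × G => ∑ γ ∈ F, f (p.1⁻¹ * γ.1 * p.2))
    (fun F => ?_) ?_
  · exact (continuous_finsetSum F fun γ _ =>
      hf.comp ((continuous_fst.inv.mul continuous_const).mul continuous_snd)).stronglyMeasurable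
  · rw [tendsto_pi_nhds]
    intro p
    exact (((hs p.1 p.2).subtype _).of_norm).hasSum

/-- The kernel restricted to the tori `S.T × S.T'` is strongly measurable. -/
theorem stronglyMeasurable_kernel_torus [SecondCountableTopology G] [Countable S.Gk] {f : G → ℂ}
    (hf : Continuous f) (hs : ∀ x y : G, Summable (fun γ : S.Gk => ‖f (x⁻¹ * γ * y)‖)) :
    StronglyMeasurable (fun p : S.T × S.T' => S.kernel f p.1 p.2) :=
  (stronglyMeasurable_kernel S hf hs).comp_measurable
    ((measurable_subtype_coe.comp measurable_fst).prodMk (measurable_subtype_coe.comp measurable_snd))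

/-- Every partial kernel restricted to the tori `S.T × S.T'` is strongly measurable. -/
theorem stronglyMeasurable_partialKernel_torus [SecondCountableTopology G] [Countable S.Gk] {f : G → ℂ}
    (hf : Continuous f) (hs : ∀ x y : G, Summable (fun γ : S.Gk => ‖f (x⁻¹ * γ * y)‖)) (o : S.Orbit) :
    StronglyMeasurable (fun p : S.T × S.T' => S.partialKernel o f p.1 p.2) :=
  (stronglyMeasurable_partialKernel S hf hs o).comp_measurable
    ((measurable_subtype_coe.comp measurable_fst).prodMk (measurable_subtype_coe.comp measurable_snd))

/-! ## 3. The orbit regrouping `K_f = ∑'_o K_f^o` -/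

omit [IsTopologicalGroup G] [BorelSpace G] in
/-- **The kernel is the sum of the partial kernels** (`HasSum` form): regrouping the absolutely summable family
`γ ↦ f(x⁻¹ γ y)` along the fibres of `orbitOf` (`HasSum.tsum_fiberwise`). -/
theorem hasSum_partialKernel {f : G → ℂ} (hs : ∀ x y : G, Summable (fun γ : S.Gk => ‖f (x⁻¹ * γ * y)‖))
    (x y : G) : HasSum (fun o : S.Orbit => S.partialKernel o f x y) (S.kernel f x y) :=
  ((hs x y).of_norm).hasSum.tsum_fiberwise S.orbitOf

omit [IsTopologicalGroup G] [BorelSpace G] in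
/-- `K_f(x, y) = ∑'_o K_f^o(x, y)`. -/
theorem kernel_eq_tsum_partialKernel {f : G → ℂ} (hs : ∀ x y : G, Summable (fun γ : S.Gk => ‖f (x⁻¹ * γ * y)‖))
    (x y : G) : S.kernel f x y = ∑' o : S.Orbit, S.partialKernel o f x y :=
  (hasSum_partialKernel S hs x y).tsum_eq.symm

omit [IsTopologicalGroup G] [BorelSpace G] in
/-- The family of partial kernels is summable. -/
theorem summable_partialKernel {f : G → ℂ} (hs : ∀ x y : G, Summable (fun γ : S.Gk => ‖f (x⁻¹ * γ * y)‖))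
    (x y : G) : Summable (fun o : S.Orbit => S.partialKernel o f x y) :=
  (hasSum_partialKernel S hs x y).summable

omit [IsTopologicalGroup G] [BorelSpace G] in
/-- The non-negative twin of the regrouping: `∑'_o ∑'_{γ ∈ o} ‖f(x⁻¹ γ y)‖ = ∑'_γ ‖f(x⁻¹ γ y)‖` (`HasSum` form). -/
theorem hasSum_tsum_norm_fiber {f : G → ℂ} (hs : ∀ x y : G, Summable (fun γ : S.Gk => ‖f (x⁻¹ * γ * y)‖))
    (x y : G) :
    HasSum (fun o : S.Orbit => ∑' γ : {γ : S.Gk // S.orbitOf γ = o}, ‖f (x⁻¹ * γ.1 * y)‖)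
      (∑' γ : S.Gk, ‖f (x⁻¹ * γ * y)‖) :=
  (hs x y).hasSum.tsum_fiberwise S.orbitOf

omit [IsTopologicalGroup G] [BorelSpace G] in
/-- `‖K_f^o(x, y)‖ ≤ ∑'_{γ ∈ o} ‖f(x⁻¹ γ y)‖`. -/
theorem norm_partialKernel_le_tsum_fiber {f : G → ℂ}
    (hs : ∀ x y : G, Summable (fun γ : S.Gk => ‖f (x⁻¹ * γ * y)‖)) (o : S.Orbit) (x y : G) :
    ‖S.partialKernel o f x y‖ ≤ ∑' γ : {γ : S.Gk // S.orbitOf γ = o}, ‖f (x⁻¹ * γ.1 * y)‖ :=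
  norm_tsum_le_tsum_norm ((hs x y).subtype _)

omit [IsTopologicalGroup G] [BorelSpace G] in
/-- `∑'_{γ ∈ o} ‖f(x⁻¹ γ y)‖ ≤ ∑'_γ ‖f(x⁻¹ γ y)‖`. -/
theorem tsum_norm_fiber_le {f : G → ℂ} (hs : ∀ x y : G, Summable (fun γ : S.Gk => ‖f (x⁻¹ * γ * y)‖))
    (o : S.Orbit) (x y : G) :
    ∑' γ : {γ : S.Gk // S.orbitOf γ = o}, ‖f (x⁻¹ * γ.1 * y)‖ ≤ ∑' γ : S.Gk, ‖f (x⁻¹ * γ * y)‖ :=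
  Summable.tsum_subtype_le (fun γ : S.Gk => ‖f (x⁻¹ * γ * y)‖) {γ | S.orbitOf γ = o} (fun _ => norm_nonneg _)
    (hs x y)

omit [IsTopologicalGroup G] [BorelSpace G] in
/-- `‖K_f^o(x, y)‖ ≤ ∑'_γ ‖f(x⁻¹ γ y)‖`. -/
theorem norm_partialKernel_le {f : G → ℂ} (hs : ∀ x y : G, Summable (fun γ : S.Gk => ‖f (x⁻¹ * γ * y)‖))
    (o : S.Orbit) (x y : G) : ‖S.partialKernel o f x y‖ ≤ ∑' γ : S.Gk, ‖f (x⁻¹ * γ * y)‖ :=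
  (norm_partialKernel_le_tsum_fiber S hs o x y).trans (tsum_norm_fiber_le S hs o x y)

omit [IsTopologicalGroup G] [BorelSpace G] in
/-- `‖K_f(x, y)‖ ≤ ∑'_γ ‖f(x⁻¹ γ y)‖`. -/
theorem norm_kernel_le {f : G → ℂ} (hs : ∀ x y : G, Summable (fun γ : S.Gk => ‖f (x⁻¹ * γ * y)‖)) (x y : G) :
    ‖S.kernel f x y‖ ≤ ∑' γ : S.Gk, ‖f (x⁻¹ * γ * y)‖ :=
  norm_tsum_le_tsum_norm (hs x y)

/-! ## 4. Integrability on the toric domains (a bounded jointly measurable `K`, then the kernels) -/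

section Domains

omit [IsTopologicalGroup G] [BorelSpace G] in
/-- The measure of a domain is finite (its closure is compact, Haar measures are finite on compacts). -/
theorem measure_DT'_lt_top : S.μT' S.DT' < ∞ := by
  haveI : IsFiniteMeasureOnCompacts S.μT' := S.haarT'.toIsFiniteMeasureOnCompacts
  exact (measure_mono subset_closure).trans_lt S.compT'.measure_lt_top

omit [IsTopologicalGroup G] [BorelSpace G] in
/-- The measure of a domain is finite. -/
theorem measure_DT_lt_top : S.μT S.DT < ∞ := by
  haveI : IsFiniteMeasureOnCompacts S.μT := S.haarT.toIsFiniteMeasureOnCompacts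
  exact (measure_mono subset_closure).trans_lt S.compT.measure_lt_top

omit [IsTopologicalGroup G] in
/-- **Inner integrability**: a jointly strongly measurable `K : S.T → S.T' → ℂ` bounded by `M` on
`closure D_T × closure D_{T′}` is integrable in `t'` over `D_{T′}` for every `t ∈ closure D_T`. -/
theorem integrableOn_DT'_of_bound {K : S.T → S.T' → ℂ} (hK : StronglyMeasurable (fun p : S.T × S.T' => K p.1 p.2)) {M : ℝ}
    (hM : ∀ t ∈ closure S.DT, ∀ t' ∈ closure S.DT', ‖K t t'‖ ≤ M) {t : S.T} (ht : t ∈ closure S.DT) :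
    IntegrableOn (fun t' : S.T' => K t t') S.DT' S.μT' := by
  refine IntegrableOn.of_bound (measure_DT'_lt_top S) ?_ M ?_
  · exact (hK.comp_measurable (measurable_const.prodMk measurable_id)).aestronglyMeasurable
  · refine ae_restrict_of_ae_restrict_of_subset subset_closure ?_
    rw [ae_restrict_iff' isClosed_closure.measurableSet]
    exact Eventually.of_forall fun t' ht' => hM t ht t' ht'

omit [IsTopologicalGroup G] in
/-- **Measurability of the inner integral**: for a jointly strongly measurable `K` and a continuous `g`,
`t ↦ ∫_{D_{T′}} g(t') K(t, t') dt'` is strongly measurable (`StronglyMeasurable.integral_prod_right'` on the finite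
measure `μ_{T′}|_{D_{T′}}`). -/
theorem stronglyMeasurable_integral_DT' [SecondCountableTopology G] {K : S.T → S.T' → ℂ} (hK : StronglyMeasurable (fun p : S.T × S.T' => K p.1 p.2))
    {g : S.T' → ℂ} (hg : Continuous g) :
    StronglyMeasurable (fun t : S.T => ∫ t' in S.DT', g t' * K t t' ∂S.μT') := by
  haveI : IsFiniteMeasure (S.μT'.restrict S.DT') := isFiniteMeasure_restrict.mpr (measure_DT'_lt_top S).ne
  haveI : SecondCountableTopology S.T := Topology.IsEmbedding.subtypeVal.secondCountableTopology
  have hF : StronglyMeasurable (fun p : S.T × S.T' => g p.2 * K p.1 p.2) :=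
    (hg.comp continuous_snd).stronglyMeasurable.mul hK
  exact hF.integral_prod_right'

omit [IsTopologicalGroup G] [BorelSpace G] in
/-- **The bound on the inner integral**: `‖∫_{D_{T′}} g(t') K(t, t') dt'‖ ≤ M · μ_{T′}(D_{T′})` for `t ∈ closure D_T`,
`‖g‖ ≤ 1`. -/
theorem norm_integral_DT'_le {K : S.T → S.T' → ℂ} {M : ℝ}
    (hM : ∀ t ∈ closure S.DT, ∀ t' ∈ closure S.DT', ‖K t t'‖ ≤ M) {g : S.T' → ℂ} (hg1 : ∀ a, ‖g a‖ ≤ 1)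
    {t : S.T} (ht : t ∈ closure S.DT) :
    ‖∫ t' in S.DT', g t' * K t t' ∂S.μT'‖ ≤ M * S.μT'.real S.DT' := by
  refine norm_setIntegral_le_of_norm_le_const (measure_DT'_lt_top S) fun t' ht' => ?_
  rw [norm_mul]
  calc ‖g t'‖ * ‖K t t'‖ ≤ 1 * ‖K t t'‖ := mul_le_mul_of_nonneg_right (hg1 t') (norm_nonneg _)
    _ = ‖K t t'‖ := one_mul _
    _ ≤ M := hM t ht t' (subset_closure ht')

omit [IsTopologicalGroup G] in
/-- **Outer integrability**: `t ↦ h(t) · ∫_{D_{T′}} g(t') K(t, t') dt'` is integrable over `D_T` for continuous `g`, `h`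
with `‖g‖ ≤ 1`, `‖h‖ ≤ 1`. -/
theorem integrableOn_integral_DT'_DT [SecondCountableTopology G] {K : S.T → S.T' → ℂ} (hK : StronglyMeasurable (fun p : S.T × S.T' => K p.1 p.2)) {M : ℝ}
    (hM : ∀ t ∈ closure S.DT, ∀ t' ∈ closure S.DT', ‖K t t'‖ ≤ M) {g : S.T' → ℂ} (hg : Continuous g)
    (hg1 : ∀ a, ‖g a‖ ≤ 1) {h : S.T → ℂ} (hh : Continuous h) (hh1 : ∀ a, ‖h a‖ ≤ 1) :
    IntegrableOn (fun t : S.T => h t * ∫ t' in S.DT', g t' * K t t' ∂S.μT') S.DT S.μT := by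
  refine IntegrableOn.of_bound (measure_DT_lt_top S) ?_ (M * S.μT'.real S.DT') ?_
  · exact (hh.stronglyMeasurable.mul (stronglyMeasurable_integral_DT' S hK hg)).aestronglyMeasurable
  · refine ae_restrict_of_ae_restrict_of_subset subset_closure ?_
    rw [ae_restrict_iff' isClosed_closure.measurableSet]
    refine Eventually.of_forall fun t ht => ?_
    rw [norm_mul]
    calc ‖h t‖ * ‖∫ t' in S.DT', g t' * K t t' ∂S.μT'‖
        ≤ 1 * ‖∫ t' in S.DT', g t' * K t t' ∂S.μT'‖ := mul_le_mul_of_nonneg_right (hh1 t) (norm_nonneg _)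
      _ = ‖∫ t' in S.DT', g t' * K t t' ∂S.μT'‖ := one_mul _
      _ ≤ M * S.μT'.real S.DT' := norm_integral_DT'_le S hM hg1 ht

end Domains

/-! ## 5. The kernels of an `L¹` test function on the toric domains -/

section Kernels

variable [SecondCountableTopology G] [Countable S.Gk]

omit [IsTopologicalGroup G] [BorelSpace G] [SecondCountableTopology G] [Countable S.Gk] in
/-- The (α)-form Poincaré bound at singletons gives pointwise absolute summability. -/
theorem summable_norm_of_poincareUniform {f : G → ℂ}
    (hP : ∀ C₁ C₂ : Set G, IsCompact C₁ → IsCompact C₂ → ∃ M : ℝ, ∀ x ∈ C₁, ∀ y ∈ C₂,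
      Summable (fun γ : S.Gk => ‖f (x⁻¹ * γ * y)‖) ∧ ∑' γ : S.Gk, ‖f (x⁻¹ * γ * y)‖ ≤ M)
    (x y : G) : Summable (fun γ : S.Gk => ‖f (x⁻¹ * γ * y)‖) := by
  obtain ⟨M, hM⟩ := hP {x} {y} isCompact_singleton isCompact_singleton
  exact (hM x (Set.mem_singleton x) y (Set.mem_singleton y)).1

omit [IsTopologicalGroup G] [BorelSpace G] [SecondCountableTopology G] [Countable S.Gk] in
/-- The (α)-form Poincaré bound on `closure D_T × closure D_{T′}`: one constant `M` with
`∑'_γ ‖f(t⁻¹ γ t')‖ ≤ M` for all `t ∈ closure D_T`, `t' ∈ closure D_{T′}`. -/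
theorem exists_bound_tsum_norm_closure {f : G → ℂ}
    (hP : ∀ C₁ C₂ : Set G, IsCompact C₁ → IsCompact C₂ → ∃ M : ℝ, ∀ x ∈ C₁, ∀ y ∈ C₂,
      Summable (fun γ : S.Gk => ‖f (x⁻¹ * γ * y)‖) ∧ ∑' γ : S.Gk, ‖f (x⁻¹ * γ * y)‖ ≤ M) :
    ∃ M : ℝ, ∀ t ∈ closure S.DT, ∀ t' ∈ closure S.DT', ∑' γ : S.Gk, ‖f ((t : G)⁻¹ * γ * t')‖ ≤ M := by
  obtain ⟨M, hM⟩ := hP ((fun t : S.T => (t : G)) '' closure S.DT) ((fun t : S.T' => (t : G)) '' closure S.DT')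
    (S.compT.image continuous_subtype_val) (S.compT'.image continuous_subtype_val)
  exact ⟨M, fun t ht t' ht' => (hM _ ⟨t, ht, rfl⟩ _ ⟨t', ht', rfl⟩).2⟩

/-- **Inner integrability for the kernel of an `L¹` test**: for `t ∈ closure D_T`, continuous `χ'` of modulus one and
any `χ`, `t' ↦ K_f(t, t') χ(t) conj χ'(t')` is integrable over `D_{T′}`. -/
theorem integrableOn_kernel_mul_DT' {f : G → ℂ} (hf : Continuous f)
    (hP : ∀ C₁ C₂ : Set G, IsCompact C₁ → IsCompact C₂ → ∃ M : ℝ, ∀ x ∈ C₁, ∀ y ∈ C₂,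
      Summable (fun γ : S.Gk => ‖f (x⁻¹ * γ * y)‖) ∧ ∑' γ : S.Gk, ‖f (x⁻¹ * γ * y)‖ ≤ M)
    (χ : S.T → ℂ) {χ' : S.T' → ℂ} (hχ' : Continuous χ') (hu' : ∀ a, ‖χ' a‖ = 1) {t : S.T}
    (ht : t ∈ closure S.DT) :
    IntegrableOn (fun t' : S.T' => S.kernel f t t' * χ t * starRingEnd ℂ (χ' t')) S.DT' S.μT' := by
  have hs := summable_norm_of_poincareUniform S hP
  obtain ⟨M, hM⟩ := exists_bound_tsum_norm_closure S hP
  have hint : IntegrableOn (fun t' : S.T' => S.kernel f t t') S.DT' S.μT' :=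
    integrableOn_DT'_of_bound S (stronglyMeasurable_kernel_torus S hf hs)
      (fun t ht t' ht' => (norm_kernel_le S hs t t').trans (hM t ht t' ht')) ht
  refine (hint.mul_const (χ t)).mul_bdd (c := 1) ?_ (Eventually.of_forall fun t' => ?_)
  · exact ((continuous_star : Continuous (starRingEnd ℂ)).comp hχ').aestronglyMeasurable
  · rw [Complex.norm_conj]
    exact (hu' t').le

/-- **Inner integrability for a partial kernel of an `L¹` test**. -/
theorem integrableOn_partialKernel_mul_DT' {f : G → ℂ} (hf : Continuous f)
    (hP : ∀ C₁ C₂ : Set G, IsCompact C₁ → IsCompact C₂ → ∃ M : ℝ, ∀ x ∈ C₁, ∀ y ∈ C₂,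
      Summable (fun γ : S.Gk => ‖f (x⁻¹ * γ * y)‖) ∧ ∑' γ : S.Gk, ‖f (x⁻¹ * γ * y)‖ ≤ M)
    (o : S.Orbit) (χ : S.T → ℂ) {χ' : S.T' → ℂ} (hχ' : Continuous χ') (hu' : ∀ a, ‖χ' a‖ = 1) {t : S.T}
    (ht : t ∈ closure S.DT) :
    IntegrableOn (fun t' : S.T' => S.partialKernel o f t t' * χ t * starRingEnd ℂ (χ' t')) S.DT' S.μT' := by
  have hs := summable_norm_of_poincareUniform S hP
  obtain ⟨M, hM⟩ := exists_bound_tsum_norm_closure S hP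
  have hint : IntegrableOn (fun t' : S.T' => S.partialKernel o f t t') S.DT' S.μT' :=
    integrableOn_DT'_of_bound S (stronglyMeasurable_partialKernel_torus S hf hs o)
      (fun t ht t' ht' => (norm_partialKernel_le S hs o t t').trans (hM t ht t' ht')) ht
  refine (hint.mul_const (χ t)).mul_bdd (c := 1) ?_ (Eventually.of_forall fun t' => ?_)
  · exact ((continuous_star : Continuous (starRingEnd ℂ)).comp hχ').aestronglyMeasurable
  · rw [Complex.norm_conj]
    exact (hu' t').le

/-- **Outer integrability for the kernel of an `L¹` test**: `t ↦ ∫_{D_{T′}} K_f(t, t') χ(t) conj χ'(t') dt'` is integrable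
over `D_T` for continuous characters of modulus one. -/
theorem integrableOn_integral_kernel_mul_DT {f : G → ℂ} (hf : Continuous f)
    (hP : ∀ C₁ C₂ : Set G, IsCompact C₁ → IsCompact C₂ → ∃ M : ℝ, ∀ x ∈ C₁, ∀ y ∈ C₂,
      Summable (fun γ : S.Gk => ‖f (x⁻¹ * γ * y)‖) ∧ ∑' γ : S.Gk, ‖f (x⁻¹ * γ * y)‖ ≤ M)
    {χ : S.T → ℂ} (hχ : Continuous χ) (hu : ∀ a, ‖χ a‖ = 1) {χ' : S.T' → ℂ} (hχ' : Continuous χ')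
    (hu' : ∀ a, ‖χ' a‖ = 1) :
    IntegrableOn (fun t : S.T => ∫ t' in S.DT', S.kernel f t t' * χ t * starRingEnd ℂ (χ' t') ∂S.μT') S.DT S.μT := by
  have hs := summable_norm_of_poincareUniform S hP
  obtain ⟨M, hM⟩ := exists_bound_tsum_norm_closure S hP
  have hK : StronglyMeasurable (fun p : S.T × S.T' => S.kernel f p.1 p.2) :=
    stronglyMeasurable_kernel_torus S hf hs
  have hM' : ∀ t ∈ closure S.DT, ∀ t' ∈ closure S.DT', ‖S.kernel f t t'‖ ≤ M :=
    fun t ht t' ht' => (norm_kernel_le S hs t t').trans (hM t ht t' ht')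
  have hg : Continuous fun a : S.T' => starRingEnd ℂ (χ' a) :=
    (continuous_star : Continuous (starRingEnd ℂ)).comp hχ'
  have hg1 : ∀ a : S.T', ‖starRingEnd ℂ (χ' a)‖ ≤ 1 := fun a => by
    rw [Complex.norm_conj]
    exact (hu' a).le
  have h := integrableOn_integral_DT'_DT S hK hM' hg hg1 hχ (fun a => (hu a).le)
  convert h using 1
  funext t
  rw [← integral_const_mul]
  congr 1
  funext t'
  ring

/-- **Outer integrability for a partial kernel of an `L¹` test**. -/
theorem integrableOn_integral_partialKernel_mul_DT {f : G → ℂ} (hf : Continuous f)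
    (hP : ∀ C₁ C₂ : Set G, IsCompact C₁ → IsCompact C₂ → ∃ M : ℝ, ∀ x ∈ C₁, ∀ y ∈ C₂,
      Summable (fun γ : S.Gk => ‖f (x⁻¹ * γ * y)‖) ∧ ∑' γ : S.Gk, ‖f (x⁻¹ * γ * y)‖ ≤ M)
    (o : S.Orbit) {χ : S.T → ℂ} (hχ : Continuous χ) (hu : ∀ a, ‖χ a‖ = 1) {χ' : S.T' → ℂ} (hχ' : Continuous χ')
    (hu' : ∀ a, ‖χ' a‖ = 1) :
    IntegrableOn (fun t : S.T => ∫ t' in S.DT', S.partialKernel o f t t' * χ t * starRingEnd ℂ (χ' t') ∂S.μT')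
      S.DT S.μT := by
  have hs := summable_norm_of_poincareUniform S hP
  obtain ⟨M, hM⟩ := exists_bound_tsum_norm_closure S hP
  have hK : StronglyMeasurable (fun p : S.T × S.T' => S.partialKernel o f p.1 p.2) :=
    stronglyMeasurable_partialKernel_torus S hf hs o
  have hM' : ∀ t ∈ closure S.DT, ∀ t' ∈ closure S.DT', ‖S.partialKernel o f t t'‖ ≤ M :=
    fun t ht t' ht' => (norm_partialKernel_le S hs o t t').trans (hM t ht t' ht')
  have hg : Continuous fun a : S.T' => starRingEnd ℂ (χ' a) :=
    (continuous_star : Continuous (starRingEnd ℂ)).comp hχ'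
  have hg1 : ∀ a : S.T', ‖starRingEnd ℂ (χ' a)‖ ≤ 1 := fun a => by
    rw [Complex.norm_conj]
    exact (hu' a).le
  have h := integrableOn_integral_DT'_DT S hK hM' hg hg1 hχ (fun a => (hu a).le)
  convert h using 1
  funext t
  rw [← integral_const_mul]
  congr 1
  funext t'
  ring

end Kernels

end Summit.Ventures.HodgeRepro.Tier4.Line4

end
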